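import Summits.QuantumFields.BalabanUV.T4Continuum.Support.SubtypeDecoupling
import Summits.QuantumFields.BalabanUV.T4Continuum.Support.DirichletScalarTowerMonotone

/-!
# `BalabanUV.T4Continuum.Support.DirichletDecoupledRegions` — NE2 (node U1a) formalisation swarm, SUPPLIER item «Δ1-DECOUPLE» under the
# owner's sub-row `T4-U1a.S-NE2-D1-DIRICHLET°` (wall `hinj`), module (2): THE EXACT LATTICE DECOUPLING OF SEPARATED SETS OF UNIT BLOCKS —
# the two-level injected DEFECT of the `U = 1` scalar Dirichlet tower over `S₁ ⊔ S₂` is the block-diagonal assembly of the two defects,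
# so the injected law passes from the pieces to the union WITH THE SAME MAJORANT; the Δ1-BESOV law (`√R/√N`) and road P2's box law
# (`Cbox/N`) extend to separated unions, and the scalar towers converge at rate `(√L)⁻¹`, resp. `L⁻¹` — the CHECKERBOARD-AT-A-VERTEX pair
# included (unit b2b-balaban-t4-ne2-formalise-leaf-08, gen 4, v1)

HONEST FRAMING.  Rung (B)+1 bookkeeping at MODEL level (U = 1 scalar layer `Δ′ = Δ + a′Π′` of [B9] (3.24), King's planting `J₀`, road
P2's compressed carriers `DOm`∕`JOm`∕`refineR`∕`blockReg` BY NAME), finite torus; EXACT finite-dimensional algebra — NOT a new analytic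
estimate; NE2 (U1a) is NOT proved by this file; Δ1 NOT closed; spine PROVED 0/9 unchanged; NOT infinite volume, NOT the mass gap, NOT
Clay.  HONEST DEPENDENCY (verbatim): «continuum YM on T⁴ ⇐ BetaPertH ∧ nine spine estimates (0/9 proved); BetaPertH ⇐ (D1) ∧ (D4) ∧
CAP+tail; G-an2-4 gates asym, D1 and NE2/3/4.»

THE OBSERVATION (unit b2b-balaban-gan24-p2 gen 23, journal l.15574; handed on by leaf-08 gen 3, l.16078): `D^Ω = (Δ + a′Π′)_{ΩΩ}` couples
two sites of `Ω` only if they are lattice-ADJACENT or lie in the SAME unit block, and `J₀` couples a fine site only to its block parent;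
so over a union of two sets of blocks with no equal and no face-adjacent pair («SEPARATED») every object of the two-level defect is
block-diagonal.  WHAT THIS FILE PROVES (0 sorry; module (1) `Support/SubtypeDecoupling` + the landed Δ1 files BY NAME):
 * §1 lattice facts: `LapS_apply_eq_zero` (`Δ(x,y) = 0` unless `y = x` or `y = x ± e_ν`), `PiS_apply_eq_zero` (`Π′(x,y) = 0` unless
   same block), `DeltaPs_apply_eq_zero`; `ne_add_unitVec_of_blockOf` ∕ `ne_sub_unitVec_of_blockOf` (a lattice step changes the block by
   at most `± e_μ` — `DirichletMonotoneCutoff.blockOf_offsF_add_of_lt/_of_eq`);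
 * §2 [shape] **`Separated M S₁ S₂`** (no block of one equals or is face-adjacent to a block of the other; `symm`, `disjoint`,
   `union_left`, `mono`), **`DeltaPs_blockReg_eq_zero`** (`Δ′_n` has NO entry between `blockReg n S₁` and `blockReg n S₂`, every `n`),
   `JK0_blockReg_eq_zero`;
 * §3 **`injected_le_of_decoupled`** (site level: `Ω = Ω₁ ⊔ Ω₂` with `Δ′_N`, `Δ′_{RN}` decoupled ⟹ both defects `≤ e` ⟹ the union's
   `≤ e`; assembly: `toBlock_eq_blockDiag` ×3, `inv_blockDiag` ×2, `blockDiag_mul_blockDiag` ×2, `blockDiag_sub_blockDiag`,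
   `opNorm_blockDiag_le`) and **`injected_le_of_separated`** ∕ `…_iff`: for SEPARATED `S₁, S₂` the two-level injected law in road P2's
   spelling passes from `S₁`, `S₂` to `S₁ ⊔ S₂` with the SAME majorant, at every `(N, R, a′)`;
 * §4 **`injected_le_of_separated_locallyMonotone`** (`besovConst d a′ 6 48·√R/√N`, leaf-08 g3's `injected_le_of_locallyMonotone` on
   each piece) and **`injected_le_of_separated_box`** (`Cbox d R a′/N`, gan24-p2's `injected_le_box` on each piece);
 * §5 tower ENDs through the owner's adapter (t4-ne2-p1 g12, `DirichletScalarTowerLevels`): **`towerLimitRate_dirichletScalar_separated_monotone`**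
   (rate `(√L)⁻¹`) and **`towerLimitRate_dirichletScalar_separated_box`** (FULL rate `L⁻¹`), displayed binders `2 ≤ L`, `0 < d`, `0 < a′`,
   `Separated`, and the class of each piece — nothing else;
 * §6 the example: `separated_diagonal_pair` (`{b₀}` and `{b₀ + e_μ + e_ν}`, `μ ≠ ν`, `M μ, M ν ≥ 2`) and
   **`towerLimitRate_dirichletScalar_checkerboardPair`** — the checkerboard-at-a-vertex region (NOT locally monotone; leaf-08 g3's located
   residue of `DirichletMonotoneCutoff`) has convergent Ω-restricted scalar covariances at the full rate `L⁻¹`.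
WHAT MOVES: the class boundary of Δ1's U = 1 SCALAR layer goes from «locally monotone» (rate `(√L)⁻¹`) ∕ «coordinate box» (rate `L⁻¹`) to
«every separated union of such pieces» (iterate §3 with `Separated.union_left`); the OPEN residue is now the FACE-CONNECTED non-monotone
configurations (the 4-chain around a vertex in `d = 2` and its kin), the full rate `L⁻¹` on connected non-box regions, and the VECTOR layer.

ABSOLUTE RULE (cell, verbatim): «No internally-minted statement may enter as a cited fact. Every hypothesis is either kernel-proved in
this package or a verbatim quotation of a PUBLISHED theorem with page reference. The manuscript(s) under audit are NOT citable for
their own disputed steps — they are the thing under adjudication; programme-internal (2001/route/tribunal) claims are never citable.»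
[folklore]; no `def … : Prop` fact (`Separated` is a decidable shape predicate with parameters); nothing printed is a hypothesis.
NOT CLAIMED: face-connected non-monotone unions; rate `N^{−1}` beyond boxes; the VECTOR operator `calDalev` ∕ the printed gauge term
(G-ne2p1-g12-1); [B9] (3.23)–(3.27) as printed; NE2; NE3; «not in print; our proof».
-/

noncomputable section

open scoped BigOperators ComplexConjugate Matrix Matrix.Norms.L2Operator
open Finset Filter Topology

namespace Summit.QuantumFields.BalabanUV.T4Continuum.DirichletDecoupledRegions

open Literature.MathematicalPhysics.QuantumFieldTheory.Balaban1983to89.B5Prop11Plancherel (Tor fine unitVec)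
open Literature.MathematicalPhysics.QuantumFieldTheory.Balaban1983to89.B5Action121 (LapS LapS_mulVec)
open Literature.MathematicalPhysics.QuantumFieldTheory.Balaban1983to89.B5Blocks16 (blockOf)
open Literature.MathematicalPhysics.QuantumFieldTheory.Balaban1983to89.B5Block118 (QsOp)
open Literature.MathematicalPhysics.QuantumFieldTheory.Balaban1983to89.B5G183RateUnitTower (lev lev_neZero)
open Summit.QuantumFields.BalabanUV.T4Continuum
open Summit.QuantumFields.BalabanUV.T4Continuum.CovariantAveragingTower (TowerLimitRate)
open Summit.QuantumFields.BalabanUV.T4Continuum.BalabanAveragedTowerUnit (one_le_lev' cast_lev')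
open Summit.QuantumFields.BalabanUV.T4Continuum.BalabanAveragedTowerModes (par)
open Summit.QuantumFields.BalabanUV.T4Continuum.BackgroundResolventTower
open Summit.QuantumFields.BalabanUV.T4Continuum.ScalarBlockPoincare (PiS PiS_mulVec QsOp_apply_blockOf)
open Summit.QuantumFields.BalabanUV.T4Continuum.ScalarAveragedPropagator (DeltaPs gammaPs)
open Summit.QuantumFields.BalabanUV.T4Continuum.ScalarBlockPlanting (JK0)
open Summit.QuantumFields.BalabanUV.T4Continuum.SubtypeDecoupling (rsel toBlock_eq_blockDiag inv_blockDiag blockDiag_mul_blockDiag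
  blockDiag_sub_blockDiag opNorm_blockDiag_le)
open Summit.QuantumFields.BalabanUV.T4Continuum.DirichletScalarTower (DsR QsR JsR)
open Summit.QuantumFields.BalabanUV.T4Continuum.DirichletScalarTowerLevels (towerLimitRate_dirichletScalar_of_sqrt_levels
  towerLimitRate_dirichletScalar_of_inv_levels)
open Summit.QuantumFields.BalabanUV.T4Continuum.DirichletScalarTowerMonotone (two_le_mul_lev)
open Summit.QuantumFields.BalabanUV.T4Continuum.DirichletBesovTwoLevel (besovConst)
open Summit.QuantumFields.BalabanUV.T4Continuum.DirichletMonotoneCutoff (LocallyMonotone offsF blockOf_offsF_add_of_lt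
  blockOf_offsF_add_of_eq)
open Summit.QuantumFields.BalabanUV.T4Continuum.DirichletMonotoneTwoLevel (injected_le_of_locallyMonotone)
open Summit.QuantumFields.BalabanUV.Beta.GAN24.DirichletBoxTrace (blockReg)
open Summit.QuantumFields.BalabanUV.Beta.GAN24.DirichletBoxCompression (DOm JOm refineR isUnit_det_DOm JK0_apply_eq_zero)
open Summit.QuantumFields.BalabanUV.Beta.GAN24.DirichletBoxTwoLevelCore (refineR_blockReg_iff)
open Summit.QuantumFields.BalabanUV.Beta.GAN24.DirichletBoxTwoLevel (IsCoordBox Cbox injected_le_box)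

variable {d : ℕ}

/-! ## §1 Lattice facts: which sites the `U = 1` scalar operator and King's planting couple -/

section Lattice

variable (n : ℕ) [NeZero n] (M : Fin d → ℕ) [hM : ∀ μ, NeZero (M μ)] (a' : ℝ)

/-- an entry of a square matrix is its action on a basis vector. [folklore] -/
theorem apply_eq_mulVec_single {α : Type*} [Fintype α] [DecidableEq α] (X : Matrix α α ℂ) (x y : α) :
    X x y = (X *ᵥ (Pi.single y 1 : α → ℂ)) x := by
  simp only [Matrix.mulVec, dotProduct, Pi.single_apply, mul_ite, mul_one, mul_zero, Finset.sum_ite_eq', Finset.mem_univ, if_true]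

/-- **the torus Laplacian couples a site only to itself and its `2d` neighbours**: `Δ(x, y) = 0` unless `y = x` or `y = x ± e_ν`. [folklore] -/
theorem LapS_apply_eq_zero (c : ℂ) {x y : Tor (fine n M)} (h0 : y ≠ x) (hp : ∀ ν, y ≠ x + unitVec (fine n M) ν)
    (hm : ∀ ν, y ≠ x - unitVec (fine n M) ν) : LapS (fine n M) c x y = 0 := by
  rw [apply_eq_mulVec_single (LapS (fine n M) c) x y, LapS_mulVec]
  refine Finset.sum_eq_zero fun ν _ => ?_
  rw [Pi.single_eq_of_ne' h0, Pi.single_eq_of_ne' (hp ν), Pi.single_eq_of_ne' (hm ν)]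
  ring

/-- **the block-mean projector couples only sites of the same unit block**: `Π′(x, y) = 0` unless `blockOf y = blockOf x`. [folklore] -/
theorem PiS_apply_eq_zero {x y : Tor (fine n M)} (h : blockOf n M y ≠ blockOf n M x) : PiS n M x y = 0 := by
  rw [apply_eq_mulVec_single (PiS n M) x y, PiS_mulVec]
  simp only [Matrix.mulVec, dotProduct, Pi.single_apply, mul_ite, mul_one, mul_zero, Finset.sum_ite_eq', Finset.mem_univ, if_true]
  rw [QsOp_apply_blockOf, if_neg h]

/-- hence `Δ′ = Δ + a′Π′` has NO entry between sites that are neither equal, nor lattice neighbours, nor in the same block. [folklore] -/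
theorem DeltaPs_apply_eq_zero {x y : Tor (fine n M)} (h0 : y ≠ x) (hp : ∀ ν, y ≠ x + unitVec (fine n M) ν)
    (hm : ∀ ν, y ≠ x - unitVec (fine n M) ν) (hb : blockOf n M y ≠ blockOf n M x) : DeltaPs n M a' x y = 0 := by
  rw [DeltaPs, Matrix.add_apply, Matrix.smul_apply, LapS_apply_eq_zero n M _ h0 hp hm, PiS_apply_eq_zero n M hb, smul_zero, add_zero]

/-- a forward neighbour lies in the same block or in the next block along `μ`; so a site whose block is neither cannot be that
neighbour. [folklore] -/
theorem ne_add_unitVec_of_blockOf {x y : Tor (fine n M)} (μ : Fin d) (hb : blockOf n M y ≠ blockOf n M x)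
    (hb' : blockOf n M y ≠ blockOf n M x + unitVec M μ) : y ≠ x + unitVec (fine n M) μ := by
  intro e
  rcases Nat.lt_or_ge ((offsF n M x μ : ℕ) + 1) n with hlt | hge
  · exact hb (e ▸ (blockOf_offsF_add_of_lt n M x μ hlt).1)
  · have heq : (offsF n M x μ : ℕ) + 1 = n := le_antisymm (offsF n M x μ).isLt hge
    exact hb' (e ▸ (blockOf_offsF_add_of_eq n M x μ heq).1)

/-- the backward twin: a site whose block is neither the block of `x` nor the previous one along `μ` is not `x − e_μ`. [folklore] -/
theorem ne_sub_unitVec_of_blockOf {x y : Tor (fine n M)} (μ : Fin d) (hb : blockOf n M y ≠ blockOf n M x)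
    (hb' : blockOf n M y + unitVec M μ ≠ blockOf n M x) : y ≠ x - unitVec (fine n M) μ := by
  intro e
  have e' : x = y + unitVec (fine n M) μ := by rw [e, sub_add_cancel]
  exact ne_add_unitVec_of_blockOf n M μ (Ne.symm hb) (fun h => hb' h.symm) e'

end Lattice

/-! ## §2 Separated sets of unit blocks -/

section Separated

variable (M : Fin d → ℕ) [hM : ∀ μ, NeZero (M μ)]

/-- [shape] two sets of unit blocks are SEPARATED when no block of one EQUALS or is FACE-ADJACENT to a block of the other (decidable,
combinatorial; the checkerboard-at-a-vertex pair is separated, a face-connected chain is not). [folklore] -/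
def Separated (S₁ S₂ : Tor M → Prop) : Prop :=
  ∀ b₁ b₂, S₁ b₁ → S₂ b₂ → b₁ ≠ b₂ ∧ ∀ μ, b₁ + unitVec M μ ≠ b₂ ∧ b₂ + unitVec M μ ≠ b₁

variable {M} {S₁ S₂ S₃ : Tor M → Prop}

omit hM in
/-- separation is symmetric. [folklore] -/
theorem Separated.symm (h : Separated M S₁ S₂) : Separated M S₂ S₁ :=
  fun b₂ b₁ h₂ h₁ => ⟨(h b₁ b₂ h₁ h₂).1.symm, fun μ => ⟨((h b₁ b₂ h₁ h₂).2 μ).2, ((h b₁ b₂ h₁ h₂).2 μ).1⟩⟩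

omit hM in
/-- separated sets are disjoint. [folklore] -/
theorem Separated.disjoint (h : Separated M S₁ S₂) {b : Tor M} (h₁ : S₁ b) : ¬ S₂ b := fun h₂ => (h b b h₁ h₂).1 rfl

omit hM in
/-- a union of two sets separated from a third is separated from it (so the two-set law below iterates over any finite family of
pairwise separated pieces). [folklore] -/
theorem Separated.union_left (h₁ : Separated M S₁ S₃) (h₂ : Separated M S₂ S₃) : Separated M (fun b => S₁ b ∨ S₂ b) S₃ :=
  fun b b₃ hb h₃ => hb.elim (fun hb₁ => h₁ b b₃ hb₁ h₃) (fun hb₂ => h₂ b b₃ hb₂ h₃)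

omit hM in
/-- monotonicity: subsets of separated sets are separated. [folklore] -/
theorem Separated.mono {T₁ T₂ : Tor M → Prop} (h : Separated M S₁ S₂) (hT₁ : ∀ b, T₁ b → S₁ b) (hT₂ : ∀ b, T₂ b → S₂ b) :
    Separated M T₁ T₂ := fun b₁ b₂ h₁ h₂ => h b₁ b₂ (hT₁ b₁ h₁) (hT₂ b₂ h₂)

variable (n : ℕ) [NeZero n] (a' : ℝ)

/-- **`Δ′` HAS NO ENTRY BETWEEN THE BLOCK REGIONS OF TWO SEPARATED SETS** (at every lattice spacing `n⁻¹`). [folklore] -/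
theorem DeltaPs_blockReg_eq_zero (hsep : Separated M S₁ S₂) {x y : Tor (fine n M)} (hx : blockReg n M S₁ x) (hy : blockReg n M S₂ y) :
    DeltaPs n M a' x y = 0 := by
  have h := hsep (blockOf n M x) (blockOf n M y) hx hy
  refine DeltaPs_apply_eq_zero n M a' (fun e => h.1 (e ▸ rfl)) (fun ν => ?_) (fun ν => ?_) (fun e => h.1 e.symm)
  · exact ne_add_unitVec_of_blockOf n M ν (fun e => h.1 e.symm) (fun e => (h.2 ν).1 e.symm)
  · exact ne_sub_unitVec_of_blockOf n M ν (fun e => h.1 e.symm) (fun e => (h.2 ν).2 e)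

variable (N R : ℕ) [NeZero N] [NeZero R]

omit [NeZero R] in
/-- **KING's PLANTING HAS NO ENTRY BETWEEN THE REFINED REGION OF ONE SET AND THE REGION OF A DISJOINT SET** (it couples a fine site only
to its parent). [folklore] -/
theorem JK0_blockReg_eq_zero (hd : ∀ b, S₁ b → ¬ S₂ b) {x : Tor (fine (R * N) M)} {y : Tor (fine N M)}
    (hx : refineR N R M (blockReg N M S₁) x) (hy : blockReg N M S₂ y) : JK0 N R M x y = 0 :=
  JK0_apply_eq_zero N R M fun e => hd (blockOf N M y) (by rw [← e]; exact hx) hy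

end Separated

/-! ## §3 THE DECOUPLING LAW for the two-level injected defect -/

section Decoupling

variable (N R : ℕ) [NeZero N] [NeZero R] (M : Fin d → ℕ) [hM : ∀ μ, NeZero (M μ)] (a' : ℝ)

/-- **THE DECOUPLING LAW, site level**: if `Ω = Ω₁ ⊔ Ω₂` with `Δ′_N` having no entry between `Ω₁` and `Ω₂` and `Δ′_{RN}` none between
their refinements, then the two-level injected DEFECT of `Ω` is the block-diagonal assembly of the two defects, hence bounded by the
larger one: both `≤ e` ⟹ the union's `≤ e` (same majorant). [folklore] -/
theorem injected_le_of_decoupled (Ω Ω₁ Ω₂ : Tor (fine N M) → Prop) [DecidablePred Ω] [DecidablePred Ω₁] [DecidablePred Ω₂]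
    (hΩ : ∀ x, Ω x ↔ Ω₁ x ∨ Ω₂ x) (hd : ∀ x, Ω₁ x → ¬ Ω₂ x)
    (hD : ∀ x y, Ω₁ x → Ω₂ y → DeltaPs N M a' x y = 0 ∧ DeltaPs N M a' y x = 0)
    (hD' : ∀ x y, refineR N R M Ω₁ x → refineR N R M Ω₂ y → DeltaPs (R * N) M a' x y = 0 ∧ DeltaPs (R * N) M a' y x = 0)
    (ha' : 0 < a') {e : ℝ}
    (h₁ : ‖(DOm (R * N) M a' (refineR N R M Ω₁))⁻¹ * JOm N R M Ω₁ - JOm N R M Ω₁ * (DOm N M a' Ω₁)⁻¹‖ ≤ e)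
    (h₂ : ‖(DOm (R * N) M a' (refineR N R M Ω₂))⁻¹ * JOm N R M Ω₂ - JOm N R M Ω₂ * (DOm N M a' Ω₂)⁻¹‖ ≤ e) :
    ‖(DOm (R * N) M a' (refineR N R M Ω))⁻¹ * JOm N R M Ω - JOm N R M Ω * (DOm N M a' Ω)⁻¹‖ ≤ e := by
  have hΩ' : ∀ x, refineR N R M Ω x ↔ refineR N R M Ω₁ x ∨ refineR N R M Ω₂ x := fun x => hΩ (par N R M x)
  have hd' : ∀ x, refineR N R M Ω₁ x → ¬ refineR N R M Ω₂ x := fun x => hd (par N R M x)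
  have hJ₁₂ : ∀ (x : Tor (fine (R * N) M)) (y : Tor (fine N M)), refineR N R M Ω₁ x → Ω₂ y → JK0 N R M x y = 0 :=
    fun x y hx hy => JK0_apply_eq_zero N R M fun e => hd y (by rw [← e]; exact hx) hy
  have hJ₂₁ : ∀ (x : Tor (fine (R * N) M)) (y : Tor (fine N M)), refineR N R M Ω₂ x → Ω₁ y → JK0 N R M x y = 0 :=
    fun x y hx hy => JK0_apply_eq_zero N R M fun e => hd y hy (by rw [← e]; exact hx)
  -- the three block-diagonal decompositions
  have eD : DOm N M a' Ω = (rsel Ω Ω₁)ᴴ * DOm N M a' Ω₁ * rsel Ω Ω₁ + (rsel Ω Ω₂)ᴴ * DOm N M a' Ω₂ * rsel Ω Ω₂ :=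
    toBlock_eq_blockDiag Ω Ω₁ Ω₂ Ω Ω₁ Ω₂ (DeltaPs N M a') hΩ hd hΩ hd (fun a b h1 h2 => (hD a b h1 h2).1)
      (fun a b h2 h1 => (hD b a h1 h2).2)
  have eD' : DOm (R * N) M a' (refineR N R M Ω) = (rsel (refineR N R M Ω) (refineR N R M Ω₁))ᴴ * DOm (R * N) M a' (refineR N R M Ω₁)
        * rsel (refineR N R M Ω) (refineR N R M Ω₁) + (rsel (refineR N R M Ω) (refineR N R M Ω₂))ᴴ * DOm (R * N) M a' (refineR N R M Ω₂)
        * rsel (refineR N R M Ω) (refineR N R M Ω₂) :=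
    toBlock_eq_blockDiag _ _ _ _ _ _ (DeltaPs (R * N) M a') hΩ' hd' hΩ' hd' (fun a b h1 h2 => (hD' a b h1 h2).1)
      (fun a b h2 h1 => (hD' b a h1 h2).2)
  have eJ : JOm N R M Ω = (rsel (refineR N R M Ω) (refineR N R M Ω₁))ᴴ * JOm N R M Ω₁ * rsel Ω Ω₁
        + (rsel (refineR N R M Ω) (refineR N R M Ω₂))ᴴ * JOm N R M Ω₂ * rsel Ω Ω₂ :=
    toBlock_eq_blockDiag _ _ _ _ _ _ (JK0 N R M) hΩ' hd' hΩ hd hJ₁₂ hJ₂₁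
  have eG : (DOm N M a' Ω)⁻¹ = (rsel Ω Ω₁)ᴴ * (DOm N M a' Ω₁)⁻¹ * rsel Ω Ω₁ + (rsel Ω Ω₂)ᴴ * (DOm N M a' Ω₂)⁻¹ * rsel Ω Ω₂ := by
    rw [eD]
    exact inv_blockDiag Ω Ω₁ Ω₂ hΩ hd _ _ (isUnit_det_DOm N M a' Ω₁ ha') (isUnit_det_DOm N M a' Ω₂ ha')
  have eG' : (DOm (R * N) M a' (refineR N R M Ω))⁻¹ = (rsel (refineR N R M Ω) (refineR N R M Ω₁))ᴴ * (DOm (R * N) M a' (refineR N R M Ω₁))⁻¹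
        * rsel (refineR N R M Ω) (refineR N R M Ω₁) + (rsel (refineR N R M Ω) (refineR N R M Ω₂))ᴴ * (DOm (R * N) M a' (refineR N R M Ω₂))⁻¹
        * rsel (refineR N R M Ω) (refineR N R M Ω₂) := by
    rw [eD']
    exact inv_blockDiag _ _ _ hΩ' hd' _ _ (isUnit_det_DOm (R * N) M a' _ ha') (isUnit_det_DOm (R * N) M a' _ ha')
  have hq₁ : ∀ x, Ω₁ x → Ω x := fun x h => (hΩ x).mpr (Or.inl h)
  have hq₂ : ∀ x, Ω₂ x → Ω x := fun x h => (hΩ x).mpr (Or.inr h)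
  have hq₁' : ∀ x, refineR N R M Ω₁ x → refineR N R M Ω x := fun x h => (hΩ' x).mpr (Or.inl h)
  have hq₂' : ∀ x, refineR N R M Ω₂ x → refineR N R M Ω x := fun x h => (hΩ' x).mpr (Or.inr h)
  rw [eG', eG, eJ, blockDiag_mul_blockDiag _ _ _ _ _ _ _ _ _ hq₁' hq₂' hd', blockDiag_mul_blockDiag _ _ _ _ _ _ _ _ _ hq₁ hq₂ hd,
    blockDiag_sub_blockDiag]
  exact opNorm_blockDiag_le _ _ _ _ _ _ hd hd' ((norm_nonneg _).trans h₁) h₁ h₂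

variable {S₁ S₂ : Tor M → Prop} [DecidablePred S₁] [DecidablePred S₂]

/-- **THE DECOUPLING LAW FOR SEPARATED SETS OF UNIT BLOCKS**, free spelling of the union (`S ↔ S₁ ∨ S₂` pointwise; U = 1 scalar
model, road P2's compressed carriers, literally the spelling of the owner's wall `hinj`∕`hinjS` and of `DirichletBoxTwoLevel.injected_le_box`):
if the two-level injected law holds with majorant `e` for `S₁` and for `S₂`, and `S₁, S₂` are SEPARATED, it holds with the SAME `e` for
their union `S`. [folklore] -/
theorem injected_le_of_separated_iff (S : Tor M → Prop) [DecidablePred S] (hS : ∀ b, S b ↔ S₁ b ∨ S₂ b) (hsep : Separated M S₁ S₂)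
    (ha' : 0 < a') {e : ℝ}
    (h₁ : ‖(DOm (R * N) M a' (refineR N R M (blockReg N M S₁)))⁻¹ * JOm N R M (blockReg N M S₁)
        - JOm N R M (blockReg N M S₁) * (DOm N M a' (blockReg N M S₁))⁻¹‖ ≤ e)
    (h₂ : ‖(DOm (R * N) M a' (refineR N R M (blockReg N M S₂)))⁻¹ * JOm N R M (blockReg N M S₂)
        - JOm N R M (blockReg N M S₂) * (DOm N M a' (blockReg N M S₂))⁻¹‖ ≤ e) :
    ‖(DOm (R * N) M a' (refineR N R M (blockReg N M S)))⁻¹ * JOm N R M (blockReg N M S)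
        - JOm N R M (blockReg N M S) * (DOm N M a' (blockReg N M S))⁻¹‖ ≤ e := by
  refine injected_le_of_decoupled N R M a' (blockReg N M S) (blockReg N M S₁) (blockReg N M S₂) (fun x => hS _)
    (fun x hx => hsep.disjoint hx) (fun x y hx hy => ?_) (fun x y hx hy => ?_) ha' h₁ h₂
  · exact ⟨DeltaPs_blockReg_eq_zero N a' hsep hx hy, DeltaPs_blockReg_eq_zero N a' hsep.symm hy hx⟩
  · rw [refineR_blockReg_iff] at hx hy
    exact ⟨DeltaPs_blockReg_eq_zero (R * N) a' hsep hx hy, DeltaPs_blockReg_eq_zero (R * N) a' hsep.symm hy hx⟩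

/-- **THE DECOUPLING LAW FOR SEPARATED SETS OF UNIT BLOCKS** (the union spelled `fun b => S₁ b ∨ S₂ b`): both two-level injected laws
`≤ e` ⟹ the union's `≤ e`, SAME majorant, every `(N, R, a′)`. [folklore] -/
theorem injected_le_of_separated (hsep : Separated M S₁ S₂) (ha' : 0 < a') {e : ℝ}
    (h₁ : ‖(DOm (R * N) M a' (refineR N R M (blockReg N M S₁)))⁻¹ * JOm N R M (blockReg N M S₁)
        - JOm N R M (blockReg N M S₁) * (DOm N M a' (blockReg N M S₁))⁻¹‖ ≤ e)
    (h₂ : ‖(DOm (R * N) M a' (refineR N R M (blockReg N M S₂)))⁻¹ * JOm N R M (blockReg N M S₂)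
        - JOm N R M (blockReg N M S₂) * (DOm N M a' (blockReg N M S₂))⁻¹‖ ≤ e) :
    ‖(DOm (R * N) M a' (refineR N R M (blockReg N M fun b => S₁ b ∨ S₂ b)))⁻¹ * JOm N R M (blockReg N M fun b => S₁ b ∨ S₂ b)
        - JOm N R M (blockReg N M fun b => S₁ b ∨ S₂ b) * (DOm N M a' (blockReg N M fun b => S₁ b ∨ S₂ b))⁻¹‖ ≤ e :=
  injected_le_of_separated_iff N R M a' (fun b => S₁ b ∨ S₂ b) (fun _ => Iff.rfl) hsep ha' h₁ h₂

/-! ## §4 Consequences BY NAME: separated unions of locally monotone pieces (Besov rate) and of boxes (full rate) -/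

/-- **SEPARATED UNIONS OF LOCALLY MONOTONE SETS OBEY THE Δ1-BESOV LAW** `besovConst d a′ 6 48·√R/√N` (leaf-08 g3's
`injected_le_of_locallyMonotone` on each piece + the decoupling law): the checkerboard-at-a-vertex pair, a union of two far-apart
L-shapes, … [folklore] -/
theorem injected_le_of_separated_locallyMonotone (hsep : Separated M S₁ S₂) (hS₁ : LocallyMonotone M S₁) (hS₂ : LocallyMonotone M S₂)
    (hN : 1 ≤ N) (hRN : 2 ≤ R * N) (ha' : 0 < a') :
    ‖(DOm (R * N) M a' (refineR N R M (blockReg N M fun b => S₁ b ∨ S₂ b)))⁻¹ * JOm N R M (blockReg N M fun b => S₁ b ∨ S₂ b)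
        - JOm N R M (blockReg N M fun b => S₁ b ∨ S₂ b) * (DOm N M a' (blockReg N M fun b => S₁ b ∨ S₂ b))⁻¹‖
      ≤ besovConst d a' 6 48 * Real.sqrt R / Real.sqrt N :=
  injected_le_of_separated N R M a' hsep ha' (injected_le_of_locallyMonotone N R M S₁ hS₁ hN hRN ha')
    (injected_le_of_locallyMonotone N R M S₂ hS₂ hN hRN ha')

/-- **SEPARATED UNIONS OF COORDINATE BOXES OBEY ROAD P2's BOX LAW** `Cbox d R a′/N` (gan24-p2's `injected_le_box` on each piece + the
decoupling law) — the FULL rate, on the first disconnected non-box regions in the tree. [folklore] -/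
theorem injected_le_of_separated_box (hsep : Separated M S₁ S₂) (hS₁ : IsCoordBox M S₁) (hS₂ : IsCoordBox M S₂) (hN : 1 ≤ N)
    (ha' : 0 < a') :
    ‖(DOm (R * N) M a' (refineR N R M (blockReg N M fun b => S₁ b ∨ S₂ b)))⁻¹ * JOm N R M (blockReg N M fun b => S₁ b ∨ S₂ b)
        - JOm N R M (blockReg N M fun b => S₁ b ∨ S₂ b) * (DOm N M a' (blockReg N M fun b => S₁ b ∨ S₂ b))⁻¹‖
      ≤ Cbox d R a' / N :=
  injected_le_of_separated N R M a' hsep ha' (injected_le_box N R M S₁ hS₁ hN ha') (injected_le_box N R M S₂ hS₂ hN ha')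

end Decoupling

/-! ## §5 The tower ENDs through the owner's level adapter -/

section Tower

variable (L : ℕ) [NeZero L] (M : Fin d → ℕ) [hM : ∀ μ, NeZero (M μ)] (a' : ℝ) {S₁ S₂ : Tor M → Prop} [DecidablePred S₁] [DecidablePred S₂]

/-- **THE Ω-RESTRICTED UNIT-LATTICE SCALAR FREE COVARIANCES OF A SEPARATED UNION OF LOCALLY MONOTONE REGIONS CONVERGE AT THE RATE
`(√L)⁻¹`** (`L ≥ 2`, `d ≥ 1`, `a′ > 0`), UNCONDITIONALLY — the owner's `towerLimitRate_dirichletScalar_of_sqrt_levels` fed with §4.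
[folklore] -/
theorem towerLimitRate_dirichletScalar_separated_monotone (hL : 2 ≤ L) (hd : 0 < d) (ha' : 0 < a') (hsep : Separated M S₁ S₂)
    (hS₁ : LocallyMonotone M S₁) (hS₂ : LocallyMonotone M S₂) :
    TowerLimitRate (QsR L M (blockReg (lev L 0) M fun b => S₁ b ∨ S₂ b)) ((L : ℝ) ^ d)
      (fun k => (DsR L M a' (blockReg (lev L 0) M fun b => S₁ b ∨ S₂ b) k)⁻¹)
      (Cpert 0 (2 * d * Real.sqrt ((gammaPs d a')⁻¹)) (besovConst d a' 6 48 * Real.sqrt (L : ℝ)) 0 0 0) ((Real.sqrt (L : ℝ))⁻¹) :=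
  towerLimitRate_dirichletScalar_of_sqrt_levels L M a' (fun b => S₁ b ∨ S₂ b) hL hd ha' fun k =>
    injected_le_of_separated_locallyMonotone (lev L k) L M a' hsep hS₁ hS₂ (one_le_lev' L k) (two_le_mul_lev L hL k) ha'

/-- **… AND OF A SEPARATED UNION OF COORDINATE BOXES AT THE FULL RATE `L⁻¹`** — the owner's `towerLimitRate_dirichletScalar_of_inv_levels`
fed with §4: e.g. two blocks touching at a vertex only. [folklore] -/
theorem towerLimitRate_dirichletScalar_separated_box (hL : 2 ≤ L) (hd : 0 < d) (ha' : 0 < a') (hsep : Separated M S₁ S₂)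
    (hS₁ : IsCoordBox M S₁) (hS₂ : IsCoordBox M S₂) :
    TowerLimitRate (QsR L M (blockReg (lev L 0) M fun b => S₁ b ∨ S₂ b)) ((L : ℝ) ^ d)
      (fun k => (DsR L M a' (blockReg (lev L 0) M fun b => S₁ b ∨ S₂ b) k)⁻¹)
      (Cpert 0 (2 * d * Real.sqrt ((gammaPs d a')⁻¹)) (Cbox d L a') 0 0 0) ((L : ℝ)⁻¹) :=
  towerLimitRate_dirichletScalar_of_inv_levels L M a' (fun b => S₁ b ∨ S₂ b) hL hd ha' fun k =>
    injected_le_of_separated_box (lev L k) L M a' hsep hS₁ hS₂ (one_le_lev' L k) ha'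

end Tower

/-! ## §6 Example: the checkerboard pair of blocks at a vertex -/

section Example

variable (M : Fin d → ℕ) [hM : ∀ μ, NeZero (M μ)]

omit hM in
/-- a single unit block is a coordinate box. [folklore] -/
theorem isCoordBox_single (b₀ : Tor M) : IsCoordBox M (fun b => b = b₀) :=
  ⟨fun μ => {b₀ μ}, fun b => by simp only [Finset.mem_singleton]; exact funext_iff⟩

omit hM in
/-- **two DIAGONAL blocks `{b₀}` and `{b₀ + e_μ + e_ν}` (`μ ≠ ν`, at least two blocks along `μ` and `ν`) are SEPARATED** — the
checkerboard-at-a-vertex configuration, NOT locally monotone as a union (leaf-08 g3's located residue of module (II)), but a separated union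
of two boxes. [folklore] -/
theorem separated_diagonal_pair (b₀ : Tor M) {μ ν : Fin d} (hμν : μ ≠ ν) (hμ : 2 ≤ M μ) (hν : 2 ≤ M ν) :
    Separated M (fun b => b = b₀) (fun b => b = b₀ + unitVec M μ + unitVec M ν) := by
  haveI : Fact (1 < M μ) := ⟨hμ⟩
  haveI : Fact (1 < M ν) := ⟨hν⟩
  have h1μ : (unitVec M μ) μ = 1 := by simp [unitVec]
  have h1ν : (unitVec M ν) ν = 1 := by simp [unitVec]
  have h0μ : (unitVec M ν) μ = 0 := by simp [unitVec, hμν]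
  have h0ν : (unitVec M μ) ν = 0 := by simp [unitVec, hμν.symm]
  intro b₁ b₂ hb₁ hb₂
  subst hb₁ hb₂
  refine ⟨fun e => ?_, fun κ => ⟨fun e => ?_, fun e => ?_⟩⟩
  · -- `b₀ = b₀ + e_μ + e_ν` ⟹ `0 = e_μ + e_ν` ⟹ at `μ`: `0 = 1`
    have e' : (0 : Tor M) = unitVec M μ + unitVec M ν := add_left_cancel (a := b₁) (by rw [add_zero, ← add_assoc]; exact e)
    have h := congrFun e' μ
    simp only [Pi.zero_apply, Pi.add_apply, h1μ, h0μ, add_zero] at h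
    exact one_ne_zero h.symm
  · -- `b₀ + e_κ = b₀ + e_μ + e_ν` ⟹ `e_κ = e_μ + e_ν`
    have e' : unitVec M κ = unitVec M μ + unitVec M ν := add_left_cancel (a := b₁) (by rw [← add_assoc]; exact e)
    by_cases hκ : κ = μ
    · rw [hκ] at e'
      have h := congrFun e' ν
      simp only [Pi.add_apply, h0ν, h1ν, zero_add] at h
      exact one_ne_zero h.symm
    · have hκμ : (unitVec M κ) μ = 0 := by simp [unitVec, Ne.symm hκ]
      have h := congrFun e' μ
      simp only [Pi.add_apply, hκμ, h1μ, h0μ, add_zero] at h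
      exact one_ne_zero h.symm
  · -- `b₀ + e_μ + e_ν + e_κ = b₀` ⟹ `e_μ + e_ν + e_κ = 0`
    have e' : unitVec M μ + unitVec M ν + unitVec M κ = 0 :=
      add_left_cancel (a := b₁) (by rw [add_zero, ← add_assoc, ← add_assoc]; exact e)
    by_cases hκ : κ = ν
    · rw [hκ] at e'
      have h := congrFun e' μ
      simp only [Pi.add_apply, Pi.zero_apply, h1μ, h0μ, add_zero] at h
      exact one_ne_zero h
    · have hκν : (unitVec M κ) ν = 0 := by simp [unitVec, Ne.symm hκ]
      have h := congrFun e' ν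
      simp only [Pi.add_apply, Pi.zero_apply, h0ν, h1ν, hκν, zero_add, add_zero] at h
      exact one_ne_zero h

/-- **THE CHECKERBOARD PAIR AT FULL RATE**: for `d ≥ 2`-type data (`μ ≠ ν`, `M μ, M ν ≥ 2`), `L ≥ 2`, `a′ > 0`, the Ω-restricted unit-lattice
scalar free covariances of the region «block `b₀` ∪ the diagonal block `b₀ + e_μ + e_ν`» CONVERGE at the rate `L⁻¹` — a NON-monotone
vertex configuration, now a theorem. [folklore] -/
theorem towerLimitRate_dirichletScalar_checkerboardPair (L : ℕ) [NeZero L] (a' : ℝ) (hL : 2 ≤ L) (hd : 0 < d) (ha' : 0 < a')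
    (b₀ : Tor M) {μ ν : Fin d} (hμν : μ ≠ ν) (hμ : 2 ≤ M μ) (hν : 2 ≤ M ν) :
    TowerLimitRate (QsR L M (blockReg (lev L 0) M fun b => b = b₀ ∨ b = b₀ + unitVec M μ + unitVec M ν)) ((L : ℝ) ^ d)
      (fun k => (DsR L M a' (blockReg (lev L 0) M fun b => b = b₀ ∨ b = b₀ + unitVec M μ + unitVec M ν) k)⁻¹)
      (Cpert 0 (2 * d * Real.sqrt ((gammaPs d a')⁻¹)) (Cbox d L a') 0 0 0) ((L : ℝ)⁻¹) :=
  towerLimitRate_dirichletScalar_separated_box L M a' hL hd ha' (separated_diagonal_pair M b₀ hμν hμ hν) (isCoordBox_single M b₀)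
    (isCoordBox_single M _)

end Example

end Summit.QuantumFields.BalabanUV.T4Continuum.DirichletDecoupledRegions

end
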